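import Literature.AlgebraicTopology.SingularHomology.CupProductProofs
import Mathlib.Algebra.CharP.Two
import Mathlib.Data.Finset.Sort
import Mathlib.Data.Finset.Max
import HarnessLib

/-!
# Cup-`i` products of singular cochains (mod 2) and their coboundary formula

N. E. Steenrod, *Products of cocycles and extensions of mappings*, Ann. of Math. 48 (1947), §5,
introduced the products `⌣ᵢ : Cᵖ(X) × Cᵠ(X) → Cᵖ⁺ᵠ⁻ⁱ(X)` of (singular or simplicial) cochains,
`⌣₀ = ⌣`, with the coboundary formula (his Thm. 5.1) which, reduced mod 2, reads
`δ(u ⌣ᵢ v) = u ⌣ᵢ₋₁ v + v ⌣ᵢ₋₁ u + δu ⌣ᵢ v + u ⌣ᵢ δv`; they define the Steenrod squares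
`Sqᵏ[u] = [u ⌣_{p-k} u]` on `Hᵖ(X; 𝔽₂)` (sequel file `SteenrodSquares.lean`).

This file constructs the `⌣ᵢ` on the tree's singular cochains (honest functions
`SingularSimplex X n → R`, `Literature.AlgebraicTopology.SingularHomology.SingularCochains`) and PROVES
the mod-2 coboundary formula. We use the closed formulas of A. Medina-Mardones, *New formulas
for cup-i products and fast computation of Steenrod squares*, Comput. Geom. 109 (2023) 101921
(arXiv:2105.08025), whose numbering we cite:

* Def. 7: for a simplex `x = [v₀, …, vₙ]` and `U = {u₁ < ⋯ < u_{n-i}} ⊆ {0, …, n}`,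
  `Δᵢ(x) = ∑_U d_{U⁰}(x) ⊗ d_{U¹}(x)`, `U⁰ = {uⱼ ∈ U | uⱼ ≡ j mod 2}`, `U¹ = U ∖ U⁰`, `d_V` the
  iterated face operator deleting the vertices in `V` (§4, Notation). Dually, for cochains with
  coefficients in a commutative ring `R`, `(φ ⌣ᵢ ψ)(σ) = ∑_U φ(d_{U⁰} σ) ψ(d_{U¹} σ)`
  (`Literature.AlgebraicTopology.SingularHomology.cochainCupI`; the position parity is
  `CupI.idx`, the splitting `CupI.part0`/`CupI.part1`, the deleted face `SingularSimplex.dface`).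
* Ex. 8: `Δ₀` is the Alexander–Whitney diagonal, the FIRST factor carrying the front face — so
  `⌣₀` is the tree's `cochainCup` (`cochainCupI_zero_eq_cochainCup`); Ex. 9: `Δₙ(x) = x ⊗ x`
  (`cochainCupI_self_apply`).
* Lemma 12: naturality (`cochainCupI_map`); Lemma 13 with §8 (Lemmas 20–23): the boundary
  formula `∂Δᵢ + Δᵢ∂ = (1 + T)Δᵢ₋₁` over `𝔽₂`, i.e. Thm. 10 (the `Δᵢ` form a cup-`i`
  construction). Dualised: `d_cochainCupI_succ`, `d_cochainCupI_zero` (for rings of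
  characteristic two).

## The proof of the coboundary formula

Exactly the printed one (§8), organised as three identities of finite sums valid for an
ARBITRARY weight `g(A, B)` on pairs of vertex sets (the weight of the proof is
`CupI.gw`, `g(A, B) = [#A + p = n+1][#B + q = n+1] φ(d_A τ) ψ(d_B τ)`, which absorbs the degree
bookkeeping):
(I) (`CupI.sum_sum_insert_map_succAbove`, Lemma 21) re-indexing the pairs `(j, U ⊆ [n])` by
`V = δⱼU ∪ {j} ⊆ [n+1]`, using that position parity is invariant under the coface maps
(`CupI.insert_map_part0/1`); (II) (`CupI.sum_sum_compl_eq`, Lemma 23) the `v ∉ U` terms of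
`δφ ⌣ᵢ ψ + φ ⌣ᵢ δψ` telescope, for each `V`, along the increasing enumeration of `V` to
`g(V⁰, V¹) + g(V¹, V⁰)` (`CupI.sum_erase_telescope`, by induction on the largest vertex); and
Lemma 20 (`SingularSimplex.sum_face_dface`): the faces of `d_A σ` are the `d_{A ∪ {v}} σ`,
`v ∉ A`. All three were also checked by brute force for `n ≤ 7` before formalisation.

## Design

* Characteristic two only: no signs anywhere; the coboundary formula is stated under
  `[CharP R 2]` (the definition makes sense over any commutative ring).
* The output degree `n` of `cochainCupI n i : Cᵖ →ₗ Cᵠ →ₗ Cⁿ` is an explicit argument and no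
  relation `p + q = n + i` is imposed: the product simply vanishes otherwise
  (`cochainCupI_eq_zero_of_ne`), which makes all identities hypothesis-free.
* Faces of the wrong cardinality are never evaluated: enumerations `CupI.monoEnum S m` of vertex
  sets carry a junk value off `#S = m + 1`, and every use is guarded by the cardinality filter of
  `cupIDomain`.

Deliberately NOT here: integral signs (Steenrod's `±`), the Steenrod squares themselves and
their properties (sequel `SteenrodSquares.lean`), Cartan and Adem relations, cup-`i` products
in relative or simplicial settings.

## References

* N. E. Steenrod, *Products of cocycles and extensions of mappings*, Ann. of Math. (2) 48
  (1947), 290–320, §5. [Steenrod1947]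
* A. M. Medina-Mardones, *New formulas for cup-i products and fast computation of Steenrod
  squares*, Comput. Geom. 109 (2023), 101921; arXiv:2105.08025. Def. 7, Ex. 8–9, Thm. 10,
  Lemmas 12–13, §8 Lemmas 20–23. [Medinamardones2023]
* A. Hatcher, *Algebraic Topology*, CUP 2002, §3.1–3.2 (singular cochains, cup product).
  [Hatcher2002]
-/

noncomputable section

open Finset

universe u v

namespace Literature.AlgebraicTopology.SingularHomology

namespace CupI

variable {N : ℕ}

/-- Medina-Mardones position parity index: for `u ∈ U = {u₁ < ⋯ < uᵣ}`, `u = uⱼ`,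
`idx U u = u + j` written as `u + #{u' ∈ U | u' < u} + 1`. [cite: Medinamardones2023, Def. 7] -/
def idx (U : Finset (Fin N)) (u : Fin N) : ℕ := (u : ℕ) + (U.filter (· < u)).card + 1

/-- `U⁰ = {uⱼ ∈ U | uⱼ + j even}`. [cite: Medinamardones2023, Def. 7] -/
def part0 (U : Finset (Fin N)) : Finset (Fin N) := U.filter fun u => Even (idx U u)

/-- `U¹ = {uⱼ ∈ U | uⱼ + j odd}`. [cite: Medinamardones2023, Def. 7] -/
def part1 (U : Finset (Fin N)) : Finset (Fin N) := U.filter fun u => ¬ Even (idx U u)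

/-- Membership in `U⁰`: `u ∈ U` with even position parity. [cite: Medinamardones2023, Def. 7] -/
lemma mem_part0 {U : Finset (Fin N)} {u : Fin N} : u ∈ part0 U ↔ u ∈ U ∧ Even (idx U u) :=
  mem_filter

/-- Membership in `U¹`: `u ∈ U` with odd position parity. [cite: Medinamardones2023, Def. 7] -/
lemma mem_part1 {U : Finset (Fin N)} {u : Fin N} : u ∈ part1 U ↔ u ∈ U ∧ ¬ Even (idx U u) :=
  mem_filter

/-- `U⁰ ⊆ U`. [folklore] -/
lemma part0_subset (U : Finset (Fin N)) : part0 U ⊆ U := filter_subset _ _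

/-- `U¹ ⊆ U`. [folklore] -/
lemma part1_subset (U : Finset (Fin N)) : part1 U ⊆ U := filter_subset _ _

/-- `U⁰` and `U¹` are disjoint. [folklore] -/
lemma disjoint_part0_part1 (U : Finset (Fin N)) : Disjoint (part0 U) (part1 U) :=
  disjoint_filter_filter_not U U _

/-- `U = U⁰ ∪ U¹`. [folklore] -/
lemma part0_union_part1 (U : Finset (Fin N)) : part0 U ∪ part1 U = U :=
  filter_union_filter_not_eq _ U

/-- `#U⁰ + #U¹ = #U`. [folklore] -/
lemma card_part0_add_card_part1 (U : Finset (Fin N)) :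
    (part0 U).card + (part1 U).card = U.card := by
  rw [← card_union_of_disjoint (disjoint_part0_part1 U), part0_union_part1]

/-- `∅⁰ = ∅`. [folklore] -/
@[simp] lemma part0_empty : part0 (∅ : Finset (Fin N)) = ∅ := by simp [part0]

/-- `∅¹ = ∅`. [folklore] -/
@[simp] lemma part1_empty : part1 (∅ : Finset (Fin N)) = ∅ := by simp [part1]

/-- Inserting an element of `U⁰` into `U⁰` does nothing. [folklore] -/
lemma insert_part0_of_mem {U : Finset (Fin N)} {v : Fin N} (h : v ∈ part0 U) :
    insert v (part0 U) = part0 U := insert_eq_of_mem h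

/-- Inserting an element of `U¹` into `U¹` does nothing. [folklore] -/
lemma insert_part1_of_mem {U : Finset (Fin N)} {v : Fin N} (h : v ∈ part1 U) :
    insert v (part1 U) = part1 U := insert_eq_of_mem h

/-! #### Inserting a new maximum -/

section InsertMax

variable {s : Finset (Fin N)} {a : Fin N}

/-- Inserting a new element `a ≥ u` does not change the position index of `u`. [folklore] -/
lemma idx_insert_of_le {u : Fin N} (hu : u ≤ a) :
    idx (insert a s) u = idx s u := by
  unfold idx
  rw [filter_insert, if_neg (not_lt.2 hu)]

/-- The position index of a new maximum `a` of `s ∪ {a}` is `a + #s + 1`. [folklore] -/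
lemma idx_insert_self (ha : ∀ x ∈ s, x < a) : idx (insert a s) a = a + s.card + 1 := by
  unfold idx
  rw [filter_insert, if_neg (lt_irrefl a), filter_true_of_mem ha]

/-- `(s ∪ {a})⁰` for a new maximum `a`: `a` joins `s⁰` iff `a + #s + 1` is even (proof of Medina-Mardones' Lemma 23, induction on the largest vertex). [cite: Medinamardones2023, §8 Lemma 23] -/
lemma part0_insert (ha : ∀ x ∈ s, x < a) :
    part0 (insert a s) = if Even ((a : ℕ) + s.card + 1) then insert a (part0 s) else part0 s := by
  have ha' : a ∉ s := fun h => lt_irrefl a (ha a h)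
  have key : (s.filter fun u => Even (idx (insert a s) u)) = part0 s :=
    filter_congr fun u hu => by rw [idx_insert_of_le (ha u hu).le]
  unfold part0
  rw [filter_insert, idx_insert_self ha]
  split_ifs with h
  · rw [key]; rfl
  · rw [key]; rfl

/-- `(s ∪ {a})¹` for a new maximum `a`: `a` joins `s¹` iff `a + #s + 1` is odd. [cite: Medinamardones2023, §8 Lemma 23] -/
lemma part1_insert (ha : ∀ x ∈ s, x < a) :
    part1 (insert a s) = if Even ((a : ℕ) + s.card + 1) then part1 s else insert a (part1 s) := by
  have ha' : a ∉ s := fun h => lt_irrefl a (ha a h)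
  have key : (s.filter fun u => ¬ Even (idx (insert a s) u)) = part1 s :=
    filter_congr fun u hu => by rw [idx_insert_of_le (ha u hu).le]
  unfold part1
  rw [filter_insert, idx_insert_self ha]
  split_ifs with h
  · rw [key]; rfl
  · rw [key]; rfl

end InsertMax

/-! #### The telescoping identity (II) -/

/-- Per-`V` telescoping: in characteristic two,
`∑_{v ∈ V} [g((V∖v)⁰ ∪ v, (V∖v)¹) + g((V∖v)⁰, (V∖v)¹ ∪ v)] = g(V⁰, V¹) + g(V¹, V⁰)`. [cite: Medinamardones2023, §8 Lemma 23] -/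
theorem sum_erase_telescope {M : Type*} [AddCommMonoid M] (h2 : ∀ x : M, x + x = 0)
    (V : Finset (Fin N)) (g : Finset (Fin N) → Finset (Fin N) → M) :
    ∑ v ∈ V, (g (insert v (part0 (V.erase v))) (part1 (V.erase v)) +
        g (part0 (V.erase v)) (insert v (part1 (V.erase v)))) =
      g (part0 V) (part1 V) + g (part1 V) (part0 V) := by
  induction V using Finset.induction_on_max generalizing g with
  | empty => simp [h2]
  | insert a s ha ih =>
    have ha' : a ∉ s := fun h => lt_irrefl a (ha a h)
    have hcancel : ∀ x y z : M, x + y + (x + z) = y + z := fun x y z => by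
      rw [show x + y + (x + z) = (x + x) + (y + z) by abel, h2, zero_add]
    have hcancel' : ∀ x y z : M, x + y + (y + z) = x + z := fun x y z => by
      rw [show x + y + (y + z) = (y + y) + (x + z) by abel, h2, zero_add]
    rw [sum_insert ha', erase_insert ha']
    -- rewrite the sum over `s`
    have hs : ∀ v ∈ s, (insert a s).erase v = insert a (s.erase v) := fun v hv =>
      erase_insert_of_ne (fun h => ha' (h ▸ hv))
    have hlt : ∀ v ∈ s, ∀ x ∈ s.erase v, x < a := fun v _ x hx => ha x (mem_of_mem_erase hx)
    have hcard : ∀ v ∈ s, (a : ℕ) + (s.erase v).card + 1 = a + s.card := fun v hv => by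
      rw [card_erase_of_mem hv, add_assoc, Nat.sub_add_cancel (card_pos.2 ⟨v, hv⟩)]
    rw [part0_insert ha, part1_insert ha]
    by_cases hpar : Even ((a : ℕ) + s.card)
    · have hpar' : ¬ Even ((a : ℕ) + s.card + 1) := fun h => by
        rw [Nat.even_add_one] at h; exact h hpar
      simp only [if_neg hpar']
      rw [sum_congr rfl fun v hv => by
        rw [hs v hv, part0_insert (hlt v hv), part1_insert (hlt v hv), hcard v hv, if_pos hpar,
          if_pos hpar, Finset.insert_comm]]
      rw [ih (fun A B => g (insert a A) B), hcancel]
    · have hpar' : Even ((a : ℕ) + s.card + 1) := by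
        rw [Nat.even_add_one]; exact hpar
      simp only [if_pos hpar']
      rw [sum_congr rfl fun v hv => by
        rw [hs v hv, part0_insert (hlt v hv), part1_insert (hlt v hv), hcard v hv, if_neg hpar,
          if_neg hpar, Finset.insert_comm]]
      rw [ih (fun A B => g A (insert a B)), hcancel']


/-- Identity (II): the `v ∉ U` terms of `δφ ⌣ᵢ ψ + φ ⌣ᵢ δψ` are `φ ⌣ᵢ₋₁ ψ + ψ ⌣ᵢ₋₁ φ`
(characteristic two). [cite: Medinamardones2023, §8 Lemma 23] -/
theorem sum_sum_compl_eq {M : Type*} [AddCommMonoid M] (h2 : ∀ x : M, x + x = 0) (i : ℕ)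
    (g : Finset (Fin N) → Finset (Fin N) → M) :
    ∑ U ∈ (univ : Finset (Fin N)).powerset with U.card + i + 1 = N, ∑ v ∈ Uᶜ,
        (g (insert v (part0 U)) (part1 U) + g (part0 U) (insert v (part1 U))) =
      ∑ V ∈ (univ : Finset (Fin N)).powerset with V.card + i = N,
        (g (part0 V) (part1 V) + g (part1 V) (part0 V)) := by
  classical
  set H : Finset (Fin N) → Fin N → M := fun U v =>
    g (insert v (part0 U)) (part1 U) + g (part0 U) (insert v (part1 U)) with hH
  set H' : Finset (Fin N) → Fin N → M := fun V v => H (V.erase v) v with hH'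
  -- right-hand side, before telescoping
  rw [← sum_congr rfl fun V _ => sum_erase_telescope h2 V g]
  change ∑ U ∈ _, ∑ v ∈ Uᶜ, H U v = ∑ V ∈ _, ∑ v ∈ V, H' V v
  -- both sides as sums over pairs `(U, v)`
  have hL : ∀ U : Finset (Fin N), ∑ v ∈ Uᶜ, H U v = ∑ v, if v ∈ U then 0 else H U v := by
    intro U
    rw [← sum_filter_add_sum_filter_not univ (· ∈ U)]
    rw [sum_congr rfl fun v hv => if_pos (mem_filter.1 hv).2, sum_const_zero, zero_add]
    rw [show Uᶜ = univ.filter (· ∉ U) from by ext; simp]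
    exact sum_congr rfl fun v hv => (if_neg (mem_filter.1 hv).2).symm
  have hR : ∀ V : Finset (Fin N), ∑ v ∈ V, H' V v = ∑ v, if v ∈ V then H' V v else 0 := by
    intro V
    rw [← sum_filter, filter_mem_eq_inter, univ_inter]
  simp_rw [hL, hR]
  rw [← sum_product' (f := fun U v => if v ∈ U then 0 else H U v),
    ← sum_product' (f := fun V v => if v ∈ V then H' V v else 0)]
  rw [show (∑ x ∈ (univ.powerset.filter fun U : Finset (Fin N) => U.card + i + 1 = N) ×ˢ univ,
        if x.2 ∈ x.1 then (0 : M) else H x.1 x.2) =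
      ∑ x ∈ ((univ.powerset.filter fun U : Finset (Fin N) => U.card + i + 1 = N) ×ˢ univ).filter
        (fun x => x.2 ∉ x.1), H x.1 x.2 by
    rw [sum_filter]; exact sum_congr rfl fun x _ => by split_ifs <;> rfl]
  rw [show (∑ x ∈ (univ.powerset.filter fun V : Finset (Fin N) => V.card + i = N) ×ˢ univ,
        if x.2 ∈ x.1 then H' x.1 x.2 else (0 : M)) =
      ∑ x ∈ ((univ.powerset.filter fun V : Finset (Fin N) => V.card + i = N) ×ˢ univ).filter
        (fun x => x.2 ∈ x.1), H' x.1 x.2 by rw [sum_filter]]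
  refine sum_nbij' (fun x => (insert x.2 x.1, x.2)) (fun x => (x.1.erase x.2, x.2)) ?_ ?_ ?_ ?_ ?_
  · rintro ⟨U, v⟩ hx
    simp only [mem_filter, mem_product, mem_powerset, mem_univ, and_true] at hx ⊢
    refine ⟨⟨subset_univ _, ?_⟩, mem_insert_self _ _⟩
    rw [card_insert_of_notMem hx.2]; omega
  · rintro ⟨V, v⟩ hx
    simp only [mem_filter, mem_product, mem_powerset, mem_univ, and_true] at hx ⊢
    refine ⟨⟨subset_univ _, ?_⟩, notMem_erase _ _⟩
    have := card_erase_add_one hx.2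
    omega
  · rintro ⟨U, v⟩ hx
    simp only [mem_filter, mem_product, mem_powerset, mem_univ, and_true] at hx
    simp [erase_insert hx.2]
  · rintro ⟨V, v⟩ hx
    simp only [mem_filter, mem_product, mem_powerset, mem_univ, and_true] at hx
    simp [insert_erase hx.2]
  · rintro ⟨U, v⟩ hx
    simp only [mem_filter, mem_product, mem_powerset, mem_univ, and_true] at hx
    simp [hH', erase_insert hx.2]

/-! #### Inserting a vertex along `Fin.succAbove` (identity (I')) -/

section SuccAbove

variable {n : ℕ}

/-- The coface map `δⱼ` transports initial segments: `{x ∈ δⱼU | x < δⱼu} = δⱼ{x ∈ U | x < u}`. [folklore] -/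
lemma filter_lt_map_succAboveEmb (j : Fin (n + 2)) (U : Finset (Fin (n + 1))) (u : Fin (n + 1)) :
    ((U.map (Fin.succAboveEmb j)).filter (· < j.succAbove u)) =
      (U.filter (· < u)).map (Fin.succAboveEmb j) := by
  rw [filter_map]
  congr 1
  exact filter_congr fun x _ => (Fin.strictMono_succAbove j).lt_iff_lt

/-- Position parity is invariant under the coface maps: the index of `δⱼ u` in `δⱼ U ∪ {j}` is that of `u` in `U` plus `0` or `2` (the re-indexing in the proof of Medina-Mardones' Lemma 21). [cite: Medinamardones2023, §8 Lemma 21] -/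
lemma even_idx_insert_map_succAbove (j : Fin (n + 2)) (U : Finset (Fin (n + 1)))
    (u : Fin (n + 1)) :
    Even (idx (insert j (U.map (Fin.succAboveEmb j))) (j.succAbove u)) ↔ Even (idx U u) := by
  have hj : j ∉ (U.filter (· < u)).map (Fin.succAboveEmb j) := fun h => by
    obtain ⟨x, -, hx⟩ := mem_map.1 h
    exact Fin.succAbove_ne j x hx
  unfold idx
  rw [filter_insert, filter_lt_map_succAboveEmb]
  rcases lt_or_ge (Fin.castSucc u) j with h | h
  · have h1 : j.succAbove u = Fin.castSucc u := Fin.succAbove_of_castSucc_lt j u h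
    have h2 : ¬ j < j.succAbove u := not_lt.2 (by rw [h1]; exact h.le)
    rw [if_neg h2, card_map, h1, Fin.val_castSucc]
  · have h1 : j.succAbove u = u.succ := Fin.succAbove_of_le_castSucc j u h
    have h2 : j < j.succAbove u := by
      rw [h1]; exact lt_of_le_of_lt h (Fin.castSucc_lt_succ)
    rw [if_pos h2, card_insert_of_notMem hj, card_map, h1, Fin.val_succ,
      show (u : ℕ) + 1 + ((U.filter (· < u)).card + 1) + 1 =
        ((u : ℕ) + (U.filter (· < u)).card + 1) + 2 by ring, Nat.even_add (n := 2)]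
    simp

/-- `δⱼ(U⁰) ∪ {j} = (δⱼU ∪ {j})⁰ ∪ {j}`. [cite: Medinamardones2023, §8 Lemma 21] -/
lemma insert_map_part0 (j : Fin (n + 2)) (U : Finset (Fin (n + 1))) :
    insert j ((part0 U).map (Fin.succAboveEmb j)) =
      insert j (part0 (insert j (U.map (Fin.succAboveEmb j)))) := by
  ext x
  simp only [mem_insert, mem_map, mem_part0]
  constructor
  · rintro (rfl | ⟨u, ⟨hu, he⟩, rfl⟩)
    · exact Or.inl rfl
    · exact Or.inr ⟨Or.inr ⟨u, hu, rfl⟩, (even_idx_insert_map_succAbove j U u).2 he⟩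
  · rintro (rfl | ⟨rfl | ⟨u, hu, rfl⟩, he⟩)
    · exact Or.inl rfl
    · exact Or.inl rfl
    · exact Or.inr ⟨u, ⟨hu, (even_idx_insert_map_succAbove j U u).1 he⟩, rfl⟩

/-- `δⱼ(U¹) ∪ {j} = (δⱼU ∪ {j})¹ ∪ {j}`. [cite: Medinamardones2023, §8 Lemma 21] -/
lemma insert_map_part1 (j : Fin (n + 2)) (U : Finset (Fin (n + 1))) :
    insert j ((part1 U).map (Fin.succAboveEmb j)) =
      insert j (part1 (insert j (U.map (Fin.succAboveEmb j)))) := by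
  ext x
  simp only [mem_insert, mem_map, mem_part1]
  constructor
  · rintro (rfl | ⟨u, ⟨hu, he⟩, rfl⟩)
    · exact Or.inl rfl
    · exact Or.inr ⟨Or.inr ⟨u, hu, rfl⟩,
        fun h => he ((even_idx_insert_map_succAbove j U u).1 h)⟩
  · rintro (rfl | ⟨rfl | ⟨u, hu, rfl⟩, he⟩)
    · exact Or.inl rfl
    · exact Or.inl rfl
    · exact Or.inr ⟨u, ⟨hu, fun h => he ((even_idx_insert_map_succAbove j U u).2 h)⟩, rfl⟩

/-- Preimage of a set of vertices of `[v₀, …, vₙ₊₁]` under the `j`-th coface map. [folklore] -/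
def preSuccAbove (j : Fin (n + 2)) (V : Finset (Fin (n + 2))) : Finset (Fin (n + 1)) :=
  univ.filter fun u => j.succAbove u ∈ V

/-- `δⱼ (δⱼ⁻¹ V) = V ∖ {j}`. [folklore] -/
lemma map_preSuccAbove (j : Fin (n + 2)) (V : Finset (Fin (n + 2))) :
    (preSuccAbove j V).map (Fin.succAboveEmb j) = V.erase j := by
  ext x
  simp only [preSuccAbove, mem_map, mem_filter, mem_univ, true_and, Fin.succAboveEmb_apply,
    mem_erase]
  constructor
  · rintro ⟨u, hu, rfl⟩
    exact ⟨Fin.succAbove_ne j u, hu⟩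
  · rintro ⟨hx, hxV⟩
    obtain ⟨u, rfl⟩ := Fin.exists_succAbove_eq hx
    exact ⟨u, hxV, rfl⟩

/-- `δⱼ⁻¹ (δⱼ U ∪ {j}) = U`. [folklore] -/
lemma preSuccAbove_insert_map (j : Fin (n + 2)) (U : Finset (Fin (n + 1))) :
    preSuccAbove j (insert j (U.map (Fin.succAboveEmb j))) = U := by
  ext u
  simp only [preSuccAbove, mem_filter, mem_univ, true_and, mem_insert,
    (Fin.succAbove_ne j u), false_or]
  exact ⟨fun h => by
    obtain ⟨x, hx, hxu⟩ := mem_map.1 h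
    rwa [← Fin.succAbove_right_injective hxu], fun h => mem_map.2 ⟨u, h, rfl⟩⟩

/-- `#(δⱼ U ∪ {j}) = #U + 1`. [folklore] -/
lemma card_insert_map_succAboveEmb (j : Fin (n + 2)) (U : Finset (Fin (n + 1))) :
    (insert j (U.map (Fin.succAboveEmb j))).card = U.card + 1 := by
  rw [card_insert_of_notMem, card_map]
  intro h
  obtain ⟨x, -, hx⟩ := mem_map.1 h
  exact Fin.succAbove_ne j x hx

/-- Identity (I): re-indexing `(j, U ⊆ [n])` by `(V ∋ j)`, `V = δⱼ U ∪ {j} ⊆ [n+1]`. [cite: Medinamardones2023, §8 Lemma 21] -/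
theorem sum_sum_insert_map_succAbove {M : Type*} [AddCommMonoid M] (i : ℕ)
    (G : Finset (Fin (n + 2)) → Fin (n + 2) → M) :
    ∑ j : Fin (n + 2), ∑ U ∈ (univ : Finset (Fin (n + 1))).powerset with U.card + i = n,
        G (insert j (U.map (Fin.succAboveEmb j))) j =
      ∑ V ∈ (univ : Finset (Fin (n + 2))).powerset with V.card + i = n + 1, ∑ j ∈ V, G V j := by
  classical
  have hR : ∀ V : Finset (Fin (n + 2)), ∑ j ∈ V, G V j = ∑ j, if j ∈ V then G V j else 0 := by
    intro V
    rw [← sum_filter, filter_mem_eq_inter, univ_inter]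
  simp_rw [hR]
  conv_rhs => rw [sum_comm]
  refine sum_congr rfl fun j _ => ?_
  rw [← sum_filter]
  refine sum_nbij' (fun U => insert j (U.map (Fin.succAboveEmb j))) (preSuccAbove j)
    ?_ ?_ ?_ ?_ ?_
  · intro U hU
    simp only [mem_filter, mem_powerset] at hU ⊢
    refine ⟨⟨subset_univ _, ?_⟩, mem_insert_self _ _⟩
    rw [card_insert_map_succAboveEmb]; omega
  · intro V hV
    simp only [mem_filter, mem_powerset] at hV ⊢
    refine ⟨subset_univ _, ?_⟩
    have h1 := congrArg Finset.card (map_preSuccAbove j V)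
    rw [card_map] at h1
    have h2 := card_erase_add_one hV.2
    omega
  · intro U _
    exact preSuccAbove_insert_map j U
  · intro V hV
    simp only [mem_filter] at hV
    rw [map_preSuccAbove, insert_erase hV.2]
  · intro U _
    rfl

end SuccAbove


/-! #### Monotone enumerations and deleted faces -/

section Faces

variable {n : ℕ}

/-- The increasing enumeration `Fin (m+1) → Fin (n+1)` of a set `S` of `m + 1` vertices of
`[v₀, …, vₙ]` (junk value the constant map `0` if `S.card ≠ m + 1`). [folklore] -/
def monoEnum (S : Finset (Fin (n + 1))) (m : ℕ) : Fin (m + 1) → Fin (n + 1) :=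
  if h : S.card = m + 1 then S.orderEmbOfFin h else fun _ => 0

variable {S : Finset (Fin (n + 1))} {m : ℕ}

/-- On a set of the right cardinality, `monoEnum` is Mathlib's `orderEmbOfFin`. [folklore] -/
lemma monoEnum_eq (h : S.card = m + 1) : monoEnum S m = S.orderEmbOfFin h := by
  unfold monoEnum; rw [dif_pos h]

/-- The enumeration takes values in the enumerated set. [folklore] -/
lemma monoEnum_mem (h : S.card = m + 1) (x : Fin (m + 1)) : monoEnum S m x ∈ S := by
  rw [monoEnum_eq h]; exact orderEmbOfFin_mem S h x

/-- The enumeration is strictly increasing. [folklore] -/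
lemma strictMono_monoEnum (h : S.card = m + 1) : StrictMono (monoEnum S m) := by
  rw [monoEnum_eq h]; exact (S.orderEmbOfFin h).strictMono

/-- The enumeration is injective. [folklore] -/
lemma injective_monoEnum (h : S.card = m + 1) : Function.Injective (monoEnum S m) :=
  (strictMono_monoEnum h).injective

/-- The enumeration is onto the enumerated set. [folklore] -/
lemma image_monoEnum (h : S.card = m + 1) : univ.image (monoEnum S m) = S := by
  rw [monoEnum_eq h, ← coe_inj, coe_image, coe_univ, Set.image_univ, range_orderEmbOfFin]

/-- Uniqueness: a strictly increasing map `Fin (m+1) → Fin (n+1)` with values in a set of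
`m + 1` vertices is its increasing enumeration. [folklore] -/
lemma monoEnum_unique (h : S.card = m + 1) {f : Fin (m + 1) → Fin (n + 1)} (hf : ∀ x, f x ∈ S)
    (hmono : StrictMono f) : f = monoEnum S m := by
  rw [monoEnum_eq h]; exact orderEmbOfFin_unique h hf hmono

/-- The enumeration of all vertices is the identity. [folklore] -/
@[simp] lemma monoEnum_univ : monoEnum (univ : Finset (Fin (n + 1))) n = id :=
  (monoEnum_unique (by simp) (fun x => mem_univ x) strictMono_id).symm

/-- The `j`-th face of an enumerated face: `enum K ∘ δⱼ = enum (K ∖ enum K j)`. [folklore] -/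
lemma monoEnum_comp_succAbove {K : Finset (Fin (n + 1))} (h : K.card = m + 2) (j : Fin (m + 2)) :
    monoEnum K (m + 1) ∘ Fin.succAbove j = monoEnum (K.erase (monoEnum K (m + 1) j)) m := by
  apply monoEnum_unique
  · rw [card_erase_of_mem (monoEnum_mem h j), h]; omega
  · intro x
    exact mem_erase.2 ⟨fun e => Fin.succAbove_ne j x (injective_monoEnum h e), monoEnum_mem h _⟩
  · exact (strictMono_monoEnum h).comp (Fin.strictMono_succAbove j)

/-- Coface maps transport enumerations: `δⱼ ∘ enum S = enum (δⱼ S)`. [folklore] -/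
lemma succAbove_comp_monoEnum (h : S.card = m + 1) (j : Fin (n + 2)) :
    Fin.succAbove j ∘ monoEnum S m = monoEnum (S.map (Fin.succAboveEmb j)) m := by
  apply monoEnum_unique
  · rw [card_map, h]
  · intro x
    exact mem_map.2 ⟨_, monoEnum_mem h x, rfl⟩
  · exact (Fin.strictMono_succAbove j).comp (strictMono_monoEnum h)

/-- `[n+1] ∖ (δⱼ A ∪ {j}) = δⱼ([n] ∖ A)`. [folklore] -/
lemma compl_insert_map_succAboveEmb (j : Fin (n + 2)) (A : Finset (Fin (n + 1))) :
    (insert j (A.map (Fin.succAboveEmb j)))ᶜ = Aᶜ.map (Fin.succAboveEmb j) := by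
  ext x
  simp only [mem_compl, mem_insert, mem_map, Fin.succAboveEmb_apply, not_or, not_exists, not_and]
  constructor
  · rintro ⟨hxj, hx⟩
    obtain ⟨u, rfl⟩ := Fin.exists_succAbove_eq hxj
    exact ⟨u, fun hu => hx u hu rfl, rfl⟩
  · rintro ⟨u, hu, rfl⟩
    exact ⟨Fin.succAbove_ne j u, fun y hy e => hu (Fin.succAbove_right_injective e ▸ hy)⟩

/-- `#([n] ∖ A) = m + 1` when `#A + m = n`. [folklore] -/
lemma card_compl_add {A : Finset (Fin (n + 1))} {m : ℕ} (h : A.card + m = n) :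
    Aᶜ.card = m + 1 := by
  rw [card_compl, Fintype.card_fin]; omega

end Faces

end CupI

namespace SingularSimplex

open CupI

variable {X Y : Type u} [TopologicalSpace X] [TopologicalSpace Y] {n m : ℕ}

/-- The face `d_A σ` of a singular `n`-simplex obtained by **deleting** the vertices in `A`
(Medina-Mardones' `d_U`), as an `m`-simplex (meaningful when `A.card + m = n`):
`σ|[v_{k₀}, …, v_{kₘ}]`, `{k₀ < ⋯ < kₘ} = [n] ∖ A`. [cite: Medinamardones2023, §4 Notation] -/
def dface (m : ℕ) (A : Finset (Fin (n + 1))) (σ : SingularSimplex X n) : SingularSimplex X m :=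
  σ.vmap (monoEnum Aᶜ m)

/-- Deleted faces commute with push-forward along continuous maps (naturality; Medina-Mardones Lemma 12). [cite: Medinamardones2023, Lemma 12] -/
lemma dface_map (f : C(X, Y)) (m : ℕ) (A : Finset (Fin (n + 1))) (σ : SingularSimplex X n) :
    (σ.map f).dface m A = (σ.dface m A).map f :=
  rfl

/-- Deleting no vertex gives back the simplex: `d_∅ σ = σ`. [cite: Medinamardones2023, §4 Notation] -/
@[simp] lemma dface_empty (σ : SingularSimplex X n) : σ.dface n ∅ = σ := by
  rw [dface, compl_empty, monoEnum_univ, vmap_id]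

/-- Faces of a coface: `d_A (σ ∘ δⱼ) = d_{δⱼ A ∪ {j}} σ`. [cite: Medinamardones2023, §8 Lemma 21] -/
lemma dface_face (j : Fin (n + 2)) (σ : SingularSimplex X (n + 1)) {A : Finset (Fin (n + 1))}
    (h : A.card + m = n) :
    (σ.face j).dface m A = σ.dface m (insert j (A.map (Fin.succAboveEmb j))) := by
  rw [dface, face_eq_vmap, vmap_vmap, succAbove_comp_monoEnum (card_compl_add h), dface,
    compl_insert_map_succAboveEmb]

/-- The codimension-one faces of a deleted face: `(d_A σ) ∘ δⱼ = d_{A ∪ {enum Aᶜ j}} σ`. [cite: Medinamardones2023, §8 Lemma 20] -/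
lemma face_dface (σ : SingularSimplex X n) {A : Finset (Fin (n + 1))} (h : A.card + (m + 1) = n)
    (j : Fin (m + 2)) :
    (σ.dface (m + 1) A).face j = σ.dface m (insert (monoEnum Aᶜ (m + 1) j) A) := by
  rw [dface, face_eq_vmap, vmap_vmap, monoEnum_comp_succAbove (card_compl_add h), dface]
  congr 2
  ext x
  simp [mem_erase, mem_compl, and_comm]

/-- Summing over the codimension-one faces of a deleted face `d_A σ` is summing over the
vertices `v ∉ A` of `d_{A ∪ {v}} σ`. [cite: Medinamardones2023, §8 Lemma 20] -/
lemma sum_face_dface {M : Type*} [AddCommMonoid M] (σ : SingularSimplex X n)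
    {A : Finset (Fin (n + 1))} (h : A.card + (m + 1) = n) (F : SingularSimplex X m → M) :
    ∑ j : Fin (m + 2), F ((σ.dface (m + 1) A).face j) = ∑ v ∈ Aᶜ, F (σ.dface m (insert v A)) := by
  simp_rw [face_dface σ h]
  conv_rhs => rw [← image_monoEnum (card_compl_add h)]
  rw [sum_image fun x _ y _ e => injective_monoEnum (card_compl_add h) e]

end SingularSimplex


/-! ### The cup-`i` products of singular cochains -/

section Cochain

open CupI

variable {R : Type v} [CommRing R]
variable {X Y : Type u} [TopologicalSpace X] [TopologicalSpace Y]
variable {p q n : ℕ}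

/-- The index set of Medina-Mardones' formula for `φ ⌣ᵢ ψ` on an `n`-simplex, `φ ∈ Cᵖ`,
`ψ ∈ Cᵠ`: the sets `U` of `n - i` vertices of `[v₀, …, vₙ]` with `#U⁰ = n - p`, `#U¹ = n - q`
(written additively; empty unless `p + q = n + i`). [cite: Medinamardones2023, Def. 7] -/
def cupIDomain (n i p q : ℕ) : Finset (Finset (Fin (n + 1))) :=
  (univ.powerset.filter fun U : Finset (Fin (n + 1)) => U.card + i = n).filter fun U =>
    (part0 U).card + p = n ∧ (part1 U).card + q = n

/-- Membership in the index set of the cup-`i` formula. [cite: Medinamardones2023, Def. 7] -/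
lemma mem_cupIDomain {n i p q : ℕ} {U : Finset (Fin (n + 1))} :
    U ∈ cupIDomain n i p q ↔
      U.card + i = n ∧ (part0 U).card + p = n ∧ (part1 U).card + q = n := by
  simp [cupIDomain]

variable (n) in
/-- The **cup-`i` product** of singular cochains (Steenrod 1947), in Medina-Mardones' form:
`(φ ⌣ᵢ ψ)(σ) = ∑_U φ(d_{U⁰} σ) · ψ(d_{U¹} σ)`, the sum over the sets `U` of `n - i` vertices of
the `n`-simplex `σ` (with `#U⁰ = n - p`, `#U¹ = n - q`), where `U = U⁰ ⊔ U¹` is the parity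
splitting `CupI.part0`/`CupI.part1` and `d_V` deletes the vertices in `V`
(`SingularSimplex.dface`). No signs: this is the product used with coefficients of
characteristic two. The output degree `n` is explicit; the product vanishes unless
`p + q = n + i`. [cite: Medinamardones2023, Def. 7 and Thm. 10] [cite: Steenrod1947, §5] -/
def cochainCupI (i : ℕ) :
    (SingularSimplex X p → R) →ₗ[R] (SingularSimplex X q → R) →ₗ[R] (SingularSimplex X n → R) :=
  LinearMap.mk₂ R
    (fun φ ψ σ ↦ ∑ U ∈ cupIDomain n i p q, φ (σ.dface p (part0 U)) * ψ (σ.dface q (part1 U)))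
    (fun _ _ _ ↦ funext fun _ ↦ by simp [Finset.sum_add_distrib, add_mul])
    (fun _ _ _ ↦ funext fun _ ↦ by simp [Finset.mul_sum, mul_assoc])
    (fun _ _ _ ↦ funext fun _ ↦ by simp [Finset.sum_add_distrib, mul_add])
    (fun _ _ _ ↦ funext fun _ ↦ by simp [Finset.mul_sum, mul_left_comm])

/-- The cup-`i` product formula `(φ ⌣ᵢ ψ)(σ) = ∑_U φ(d_{U⁰} σ) ψ(d_{U¹} σ)`. [cite: Medinamardones2023, Def. 7] -/
lemma cochainCupI_apply (i : ℕ) (φ : SingularSimplex X p → R) (ψ : SingularSimplex X q → R)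
    (σ : SingularSimplex X n) :
    cochainCupI n i φ ψ σ =
      ∑ U ∈ cupIDomain n i p q, φ (σ.dface p (part0 U)) * ψ (σ.dface q (part1 U)) :=
  rfl

/-- `φ ⌣ᵢ ψ` as a sum over all `U` with `#U + i = n`, the cardinality conditions as an
indicator. [cite: Medinamardones2023, Def. 7] -/
lemma cochainCupI_apply_ite (i : ℕ) (φ : SingularSimplex X p → R) (ψ : SingularSimplex X q → R)
    (σ : SingularSimplex X n) :
    cochainCupI n i φ ψ σ =
      ∑ U ∈ univ.powerset with U.card + i = n,
        if (part0 U).card + p = n ∧ (part1 U).card + q = n then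
          φ (σ.dface p (part0 U)) * ψ (σ.dface q (part1 U)) else 0 := by
  rw [cochainCupI_apply, cupIDomain, sum_filter]

/-- Naturality of the cup-`i` products: `f^♯(φ ⌣ᵢ ψ) = f^♯φ ⌣ᵢ f^♯ψ`. [cite: Steenrod1947, §5] -/
lemma cochainCupI_map (f : C(X, Y)) (i : ℕ) (φ : SingularSimplex Y p → R)
    (ψ : SingularSimplex Y q → R) :
    (singularCochainComplex.map R R f).f n (cochainCupI n i φ ψ) =
      cochainCupI n i ((singularCochainComplex.map R R f).f p φ)
        ((singularCochainComplex.map R R f).f q ψ) := by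
  ext σ
  simp only [singularCochainComplex.map_apply, cochainCupI_apply, SingularSimplex.dface_map]

/-- In characteristic two the coboundary has no signs: `(δφ)(σ) = ∑ⱼ φ(σ ∘ δⱼ)`. [folklore] -/
lemma d_apply_of_charTwo [CharP R 2] {m : ℕ} (φ : SingularSimplex X m → R)
    (σ : SingularSimplex X (m + 1)) :
    (singularCochainComplex R R X).d m (m + 1) φ σ = ∑ j : Fin (m + 2), φ (σ.face j) := by
  rw [singularCochainComplex.d_apply]
  exact sum_congr rfl fun j _ => by rw [CharTwo.neg_eq, one_pow, one_smul]

/-! #### Proof of the coboundary formula -/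

namespace CupI

variable (τ : SingularSimplex X (n + 1)) (φ : SingularSimplex X p → R)
  (ψ : SingularSimplex X q → R)

/-- The generic weight `g(A, B) = [#A + p = n+1][#B + q = n+1] φ(d_A τ) ψ(d_B τ)` of the proof
of the coboundary formula. [folklore] -/
def gw (A B : Finset (Fin (n + 2))) : R :=
  if A.card + p = n + 1 ∧ B.card + q = n + 1 then φ (τ.dface p A) * ψ (τ.dface q B) else 0

/-- The summands of `(φ ⌣ᵢ ψ)(τ ∘ δⱼ)` in generic form: `d_A(τ ∘ δⱼ) = d_{δⱼA ∪ {j}} τ` (Medina-Mardones, proof of Lemma 21). [cite: Medinamardones2023, §8 Lemma 21] -/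
lemma gw_face (j : Fin (n + 2)) (U : Finset (Fin (n + 1))) :
    (if (part0 U).card + p = n ∧ (part1 U).card + q = n then
        φ ((τ.face j).dface p (part0 U)) * ψ ((τ.face j).dface q (part1 U)) else 0) =
      gw τ φ ψ (insert j ((part0 U).map (Fin.succAboveEmb j)))
        (insert j ((part1 U).map (Fin.succAboveEmb j))) := by
  unfold gw
  rw [card_insert_map_succAboveEmb, card_insert_map_succAboveEmb]
  by_cases h0 : (part0 U).card + p = n
  · by_cases h1 : (part1 U).card + q = n
    · rw [if_pos ⟨h0, h1⟩, if_pos ⟨by omega, by omega⟩, SingularSimplex.dface_face j τ h0,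
        SingularSimplex.dface_face j τ h1]
    · rw [if_neg (fun h => h1 h.2), if_neg (fun h => h1 (by omega))]
  · rw [if_neg (fun h => h0 h.1), if_neg (fun h => h0 (by omega))]

/-- The left-hand side `δ(φ ⌣ᵢ ψ)(τ)` in generic form. [cite: Medinamardones2023, §8 Lemma 21] -/
lemma d_cochainCupI_apply [CharP R 2] (i : ℕ) :
    (singularCochainComplex R R X).d n (n + 1) (cochainCupI n i φ ψ) τ =
      ∑ V ∈ univ.powerset with V.card + i = n + 1, ∑ j ∈ V,
        gw τ φ ψ (insert j (part0 V)) (insert j (part1 V)) := by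
  rw [d_apply_of_charTwo]
  simp_rw [cochainCupI_apply_ite, gw_face, insert_map_part0, insert_map_part1]
  exact sum_sum_insert_map_succAbove i fun V j => gw τ φ ψ (insert j (part0 V)) (insert j (part1 V))

/-- `(δφ ⌣ᵢ ψ)(τ)` in generic form. [cite: Medinamardones2023, §8 Lemma 20 and proof of Lemma 22] -/
lemma cochainCupI_d_left_apply [CharP R 2] (i : ℕ) :
    cochainCupI (n + 1) i ((singularCochainComplex R R X).d p (p + 1) φ) ψ τ =
      ∑ V ∈ univ.powerset with V.card + i = n + 1, ∑ v ∈ (part0 V)ᶜ,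
        gw τ φ ψ (insert v (part0 V)) (part1 V) := by
  rw [cochainCupI_apply_ite]
  refine sum_congr rfl fun V _ => ?_
  unfold gw
  by_cases h : (part0 V).card + (p + 1) = n + 1 ∧ (part1 V).card + q = n + 1
  · rw [if_pos h, d_apply_of_charTwo, SingularSimplex.sum_face_dface τ h.1, sum_mul]
    refine sum_congr rfl fun v hv => ?_
    rw [if_pos ⟨by rw [card_insert_of_notMem (mem_compl.1 hv)]; omega, h.2⟩]
  · rw [if_neg h]
    symm
    refine sum_eq_zero fun v hv => if_neg fun h' => h ⟨?_, h'.2⟩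
    rw [card_insert_of_notMem (mem_compl.1 hv)] at h'
    omega

/-- `(φ ⌣ᵢ δψ)(τ)` in generic form. [cite: Medinamardones2023, §8 Lemma 20 and proof of Lemma 22] -/
lemma cochainCupI_d_right_apply [CharP R 2] (i : ℕ) :
    cochainCupI (n + 1) i φ ((singularCochainComplex R R X).d q (q + 1) ψ) τ =
      ∑ V ∈ univ.powerset with V.card + i = n + 1, ∑ v ∈ (part1 V)ᶜ,
        gw τ φ ψ (part0 V) (insert v (part1 V)) := by
  rw [cochainCupI_apply_ite]
  refine sum_congr rfl fun V _ => ?_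
  unfold gw
  by_cases h : (part0 V).card + p = n + 1 ∧ (part1 V).card + (q + 1) = n + 1
  · rw [if_pos h, d_apply_of_charTwo, SingularSimplex.sum_face_dface τ h.2, mul_sum]
    refine sum_congr rfl fun v hv => ?_
    rw [if_pos ⟨h.1, by rw [card_insert_of_notMem (mem_compl.1 hv)]; omega⟩]
  · rw [if_neg h]
    symm
    refine sum_eq_zero fun v hv => if_neg fun h' => h ⟨h'.1, ?_⟩
    rw [card_insert_of_notMem (mem_compl.1 hv)] at h'
    omega

/-- `(φ ⌣ₖ ψ)(τ)` in generic form. [cite: Medinamardones2023, Def. 7] -/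
lemma cochainCupI_apply_gw (k : ℕ) :
    cochainCupI (n + 1) k φ ψ τ =
      ∑ V ∈ univ.powerset with V.card + k = n + 1, gw τ φ ψ (part0 V) (part1 V) := by
  rw [cochainCupI_apply_ite]; rfl

/-- `(ψ ⌣ₖ φ)(τ)` in generic form. [cite: Medinamardones2023, Def. 7] -/
lemma cochainCupI_apply_gw_swap (k : ℕ) :
    cochainCupI (n + 1) k ψ φ τ =
      ∑ V ∈ univ.powerset with V.card + k = n + 1, gw τ φ ψ (part1 V) (part0 V) := by
  rw [cochainCupI_apply_ite]
  refine sum_congr rfl fun V _ => ?_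
  unfold gw
  rw [mul_comm]
  exact if_congr and_comm rfl rfl

/-- `[n+1] ∖ V⁰ = V¹ ⊔ ([n+1] ∖ V)`. [folklore] -/
lemma compl_part0_eq (V : Finset (Fin (n + 2))) : (part0 V)ᶜ = part1 V ∪ Vᶜ := by
  ext x
  simp only [mem_compl, mem_union, mem_part0, mem_part1, not_and]
  tauto

/-- `[n+1] ∖ V¹ = V⁰ ⊔ ([n+1] ∖ V)`. [folklore] -/
lemma compl_part1_eq (V : Finset (Fin (n + 2))) : (part1 V)ᶜ = part0 V ∪ Vᶜ := by
  ext x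
  simp only [mem_compl, mem_union, mem_part0, mem_part1, not_and, not_not]
  tauto

/-- `V¹` is disjoint from the complement of `V`. [folklore] -/
lemma disjoint_part1_compl (V : Finset (Fin (n + 2))) : Disjoint (part1 V) Vᶜ :=
  disjoint_compl_right.mono_left (part1_subset V)

/-- `V⁰` is disjoint from the complement of `V`. [folklore] -/
lemma disjoint_part0_compl (V : Finset (Fin (n + 2))) : Disjoint (part0 V) Vᶜ :=
  disjoint_compl_right.mono_left (part0_subset V)

/-- The coboundary formula with the `v ∉ V` terms collected:
`δ(φ ⌣ᵢ ψ) = δφ ⌣ᵢ ψ + φ ⌣ᵢ δψ + E`, `E = ∑_{#V' + i = n+2} [g(V'⁰, V'¹) + g(V'¹, V'⁰)]`. [cite: Medinamardones2023, §8 Lemmas 22 and 23] -/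
lemma d_cochainCupI_apply_eq [CharP R 2] (i : ℕ) :
    (singularCochainComplex R R X).d n (n + 1) (cochainCupI n i φ ψ) τ =
      cochainCupI (n + 1) i ((singularCochainComplex R R X).d p (p + 1) φ) ψ τ +
      cochainCupI (n + 1) i φ ((singularCochainComplex R R X).d q (q + 1) ψ) τ +
      ∑ V ∈ univ.powerset with V.card + i = n + 2,
        (gw τ φ ψ (part0 V) (part1 V) + gw τ φ ψ (part1 V) (part0 V)) := by
  have hF : (univ.powerset.filter fun U : Finset (Fin (n + 2)) => U.card + i + 1 = n + 2) =
      univ.powerset.filter fun U => U.card + i = n + 1 :=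
    filter_congr fun U _ => ⟨fun h => by omega, fun h => by omega⟩
  rw [d_cochainCupI_apply, cochainCupI_d_left_apply, cochainCupI_d_right_apply,
    ← sum_sum_compl_eq CharTwo.add_self_eq_zero i (gw τ φ ψ), hF]
  have hL : ∀ V : Finset (Fin (n + 2)),
      ∑ j ∈ V, gw τ φ ψ (insert j (part0 V)) (insert j (part1 V)) =
        ∑ j ∈ part0 V, gw τ φ ψ (part0 V) (insert j (part1 V)) +
          ∑ j ∈ part1 V, gw τ φ ψ (insert j (part0 V)) (part1 V) := by
    intro V
    have hu := sum_union (disjoint_part0_part1 V)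
      (f := fun j => gw τ φ ψ (insert j (part0 V)) (insert j (part1 V)))
    rw [part0_union_part1] at hu
    rw [hu]
    congr 1
    · exact sum_congr rfl fun j hj => by rw [insert_eq_of_mem hj]
    · exact sum_congr rfl fun j hj => by rw [insert_eq_of_mem hj]
  simp_rw [hL, compl_part0_eq, compl_part1_eq, sum_union (disjoint_part1_compl _),
    sum_union (disjoint_part0_compl _), sum_add_distrib]
  set a := ∑ V ∈ univ.powerset with V.card + i = n + 1,
    ∑ j ∈ part1 V, gw τ φ ψ (insert j (part0 V)) (part1 V)
  set b := ∑ V ∈ univ.powerset with V.card + i = n + 1,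
    ∑ j ∈ Vᶜ, gw τ φ ψ (insert j (part0 V)) (part1 V)
  set c := ∑ V ∈ univ.powerset with V.card + i = n + 1,
    ∑ j ∈ part0 V, gw τ φ ψ (part0 V) (insert j (part1 V))
  set d := ∑ V ∈ univ.powerset with V.card + i = n + 1,
    ∑ j ∈ Vᶜ, gw τ φ ψ (part0 V) (insert j (part1 V))
  rw [show a + b + (c + d) + (b + d) = c + a + ((b + d) + (b + d)) by ring,
    CharTwo.add_self_eq_zero, add_zero]

/-- `[n]⁰ = ∅`: in `U = {0, …, N-1}` every `uⱼ = j - 1` has odd `uⱼ + j`. [cite: Medinamardones2023, Def. 7] -/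
lemma part0_univ {N : ℕ} : part0 (univ : Finset (Fin N)) = ∅ := by
  refine filter_false_of_mem fun u _ => ?_
  rw [idx, Finset.filter_gt_eq_Iio, Fin.card_Iio, Nat.not_even_iff_odd]
  exact ⟨u, by ring⟩

/-- `[n]¹ = [n]`. [cite: Medinamardones2023, Def. 7] -/
lemma part1_univ {N : ℕ} : part1 (univ : Finset (Fin N)) = univ := by
  have h := part0_union_part1 (univ : Finset (Fin N))
  rwa [part0_univ, empty_union] at h

end CupI

/-- **Coboundary formula for the cup-`i` products**, characteristic two (Steenrod 1947, §5,
Thm. 5.1, mod 2; Medina-Mardones 2023, Lemma 13: "∂ ∘ Δᵢ + Δᵢ ∘ ∂ = (1 + T)Δᵢ₋₁", dualised and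
proved through his Lemmas 20–23):
`δ(φ ⌣ᵢ₊₁ ψ) = δφ ⌣ᵢ₊₁ ψ + φ ⌣ᵢ₊₁ δψ + φ ⌣ᵢ ψ + ψ ⌣ᵢ φ`. [cite: Medinamardones2023, Lemma 13] [cite: Steenrod1947, §5 Thm. 5.1] -/
theorem d_cochainCupI_succ [CharP R 2] (i : ℕ) (φ : SingularSimplex X p → R)
    (ψ : SingularSimplex X q → R) :
    (singularCochainComplex R R X).d n (n + 1) (cochainCupI n (i + 1) φ ψ) =
      cochainCupI (n + 1) (i + 1) ((singularCochainComplex R R X).d p (p + 1) φ) ψ +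
      cochainCupI (n + 1) (i + 1) φ ((singularCochainComplex R R X).d q (q + 1) ψ) +
      cochainCupI (n + 1) i φ ψ + cochainCupI (n + 1) i ψ φ := by
  refine singularCochainComplex.ext fun τ ↦ ?_
  change _ = _ + _ + cochainCupI (n + 1) i φ ψ τ + cochainCupI (n + 1) i ψ φ τ
  have hF : (univ.powerset.filter fun V : Finset (Fin (n + 2)) => V.card + (i + 1) = n + 2) =
      univ.powerset.filter fun V => V.card + i = n + 1 :=
    filter_congr fun V _ => ⟨fun h => by omega, fun h => by omega⟩
  rw [CupI.d_cochainCupI_apply_eq, hF, CupI.cochainCupI_apply_gw τ φ ψ i,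
    CupI.cochainCupI_apply_gw_swap τ φ ψ i, sum_add_distrib]
  exact (add_assoc _ _ _).symm

/-- **The cup-`0` Leibniz rule**, characteristic two: `δ(φ ⌣₀ ψ) = δφ ⌣₀ ψ + φ ⌣₀ δψ`
(Medina-Mardones 2023, Lemma 13 at `i = 0`: `Δ₀` is a chain map). [cite: Medinamardones2023, Lemma 13] -/
theorem d_cochainCupI_zero [CharP R 2] (φ : SingularSimplex X p → R)
    (ψ : SingularSimplex X q → R) :
    (singularCochainComplex R R X).d n (n + 1) (cochainCupI n 0 φ ψ) =
      cochainCupI (n + 1) 0 ((singularCochainComplex R R X).d p (p + 1) φ) ψ +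
      cochainCupI (n + 1) 0 φ ((singularCochainComplex R R X).d q (q + 1) ψ) := by
  refine singularCochainComplex.ext fun τ ↦ ?_
  change _ = cochainCupI (n + 1) 0 ((singularCochainComplex R R X).d p (p + 1) φ) ψ τ +
    cochainCupI (n + 1) 0 φ ((singularCochainComplex R R X).d q (q + 1) ψ) τ
  rw [CupI.d_cochainCupI_apply_eq, add_eq_left]
  refine sum_eq_zero fun V hV => ?_
  have hVu : V = univ := by
    apply eq_univ_of_card
    simp only [mem_filter, add_zero] at hV
    rw [hV.2, Fintype.card_fin]
  subst hVu
  simp only [CupI.gw, CupI.part0_univ, CupI.part1_univ, card_empty, zero_add, card_univ,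
    Fintype.card_fin]
  rw [if_neg fun h => by omega, if_neg fun h => by omega, add_zero]

/-! #### `⌣₀` is the Alexander–Whitney cup product; `⌣ₚ` on `Cᵖ` is the pointwise square -/

namespace CupI

/-- `([n] ∖ {k})¹ = {u | u < k}` (Medina-Mardones, Ex. 8: `Δ₀` is Alexander–Whitney). [cite: Medinamardones2023, Ex. 8] -/
lemma part1_univ_erase (k : Fin (n + 1)) : part1 (univ.erase k) = Iio k := by
  ext u
  rw [mem_part1, mem_Iio, mem_erase, idx, filter_erase, Finset.filter_gt_eq_Iio]
  constructor
  · rintro ⟨⟨hne, -⟩, hodd⟩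
    rcases lt_or_gt_of_ne hne with h | h
    · exact h
    · exfalso
      refine hodd ⟨u, ?_⟩
      rw [card_erase_of_mem (mem_Iio.2 h), Fin.card_Iio]
      have : 0 < (u : ℕ) := lt_of_le_of_lt (Nat.zero_le _) (Fin.lt_def.1 h)
      omega
  · intro h
    refine ⟨⟨h.ne, mem_univ _⟩, ?_⟩
    rw [erase_eq_of_notMem (fun h' => lt_asymm h (mem_Iio.1 h')), Fin.card_Iio,
      Nat.not_even_iff_odd]
    exact ⟨u, by ring⟩

/-- `([n] ∖ {k})⁰ = {u | k < u}` (Medina-Mardones, Ex. 8). [cite: Medinamardones2023, Ex. 8] -/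
lemma part0_univ_erase (k : Fin (n + 1)) : part0 (univ.erase k) = Ioi k := by
  have hu := part0_union_part1 (univ.erase k)
  have hd := disjoint_part0_part1 (univ.erase k)
  rw [part1_univ_erase] at hu hd
  ext u
  simp only [mem_Ioi]
  constructor
  · intro h
    have hU : u ∈ univ.erase k := hu ▸ mem_union_left _ h
    have hne : u ≠ k := (mem_erase.1 hU).1
    rcases lt_or_gt_of_ne hne with h' | h'
    · exact absurd (mem_Iio.2 h') (disjoint_left.1 hd h)
    · exact h'
  · intro h
    have hU : u ∈ univ.erase k := mem_erase.2 ⟨h.ne', mem_univ _⟩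
    rw [← hu, mem_union] at hU
    exact hU.resolve_right fun h' => lt_asymm h (mem_Iio.1 h')

/-- For `i = 0` and `p + q = n` the only index set is `U = [n] ∖ {p}`. [cite: Medinamardones2023, Ex. 8] -/
lemma cupIDomain_zero (h : p + q = n) :
    cupIDomain n 0 p q = {univ.erase (⟨p, by omega⟩ : Fin (n + 1))} := by
  ext U
  rw [mem_cupIDomain, mem_singleton, add_zero]
  constructor
  · rintro ⟨hU, -, h1⟩
    have hc : Uᶜ.card = 1 := by rw [card_compl, hU, Fintype.card_fin]; omega
    obtain ⟨k, hk⟩ := card_eq_one.1 hc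
    have hUk : U = univ.erase k := by rw [← compl_singleton, ← hk, compl_compl]
    subst hUk
    rw [part1_univ_erase, Fin.card_Iio] at h1
    congr 1
    exact Fin.ext (by simp only; omega)
  · rintro rfl
    refine ⟨?_, ?_, ?_⟩
    · rw [card_erase_of_mem (mem_univ _), card_univ, Fintype.card_fin]; rfl
    · rw [part0_univ_erase, Fin.card_Ioi]; simp only; omega
    · rw [part1_univ_erase, Fin.card_Iio]; simp only; omega

/-- The enumeration of `{0, …, p}` is the front-face vertex map. [folklore] -/
lemma monoEnum_Iic (h : p ≤ n) :
    monoEnum (Iic (⟨p, by omega⟩ : Fin (n + 1))) p = SingularSimplex.frontMap p n h := by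
  symm
  apply monoEnum_unique
  · rw [Fin.card_Iic]
  · intro x
    rw [mem_Iic, Fin.le_def]
    exact Nat.le_of_lt_succ x.2
  · intro a b hab
    exact hab

/-- The enumeration of `{n-q, …, n}` is the back-face vertex map. [folklore] -/
lemma monoEnum_Ici (h : q ≤ n) :
    monoEnum (Ici (⟨n - q, by omega⟩ : Fin (n + 1))) q = SingularSimplex.backMap q n h := by
  symm
  apply monoEnum_unique
  · rw [Fin.card_Ici]; simp only; omega
  · intro x
    rw [mem_Ici, Fin.le_def]
    exact Nat.le_add_left _ _
  · intro a b hab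
    change (a : ℕ) + (n - q) < (b : ℕ) + (n - q)
    exact Nat.add_lt_add_right hab _

end CupI

/-- **`⌣₀` is the cup product**: Medina-Mardones' `Δ₀` is the Alexander–Whitney diagonal
`∑ⱼ d_{j+1}⋯d_n(x) ⊗ d_0⋯d_{j-1}(x)`, the first tensor factor carrying the FRONT face
(Medina-Mardones 2023, Ex. 8), so `φ ⌣₀ ψ` is the tree's `cochainCup` (Hatcher's `φ(σ|[v₀…vₚ])ψ(σ|[vₚ…vₙ])`).
[cite: Medinamardones2023, Ex. 8] -/
theorem cochainCupI_zero_eq_cochainCup (h : p + q = n) (φ : SingularSimplex X p → R)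
    (ψ : SingularSimplex X q → R) : cochainCupI n 0 φ ψ = cochainCup h φ ψ := by
  refine funext fun σ ↦ ?_
  rw [cochainCupI_apply, cochainCup_apply, CupI.cupIDomain_zero h, sum_singleton,
    CupI.part0_univ_erase, CupI.part1_univ_erase, SingularSimplex.dface, SingularSimplex.dface,
    SingularSimplex.frontFace_eq_vmap, SingularSimplex.backFace_eq_vmap,
    show (Ioi (⟨p, by omega⟩ : Fin (n + 1)))ᶜ = Iic ⟨p, by omega⟩ from by ext; simp,
    show (Iio (⟨p, by omega⟩ : Fin (n + 1)))ᶜ = Ici ⟨n - q, by omega⟩ from by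
      ext x; simp [Fin.le_def, Fin.lt_def]; omega,
    CupI.monoEnum_Iic, CupI.monoEnum_Ici]

/-- **`⌣ₚ` on `p`-cochains is the pointwise product**: `(φ ⌣ₚ ψ)(σ) = φ(σ) ψ(σ)` (the only
term is `U = ∅`: Medina-Mardones 2023, Ex. 9, `Δₙ(x) = x ⊗ x`; this gives `Sq⁰ = id` over `𝔽₂`).
[cite: Medinamardones2023, Ex. 9] -/
theorem cochainCupI_self_apply (φ ψ : SingularSimplex X p → R) (σ : SingularSimplex X p) :
    cochainCupI p p φ ψ σ = φ σ * ψ σ := by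
  have hD : cupIDomain p p p p = {∅} := by
    ext U
    rw [mem_cupIDomain, mem_singleton]
    constructor
    · rintro ⟨hU, -, -⟩
      exact card_eq_zero.1 (by omega)
    · rintro rfl
      simp
  rw [cochainCupI_apply, hD, sum_singleton, CupI.part0_empty, CupI.part1_empty,
    SingularSimplex.dface_empty]

/-- The cup-`i` product `Cᵖ × Cᵠ → Cⁿ` vanishes unless `p + q = n + i`. [cite: Steenrod1947, §5] -/
theorem cochainCupI_eq_zero_of_ne {i : ℕ} (h : p + q ≠ n + i) (φ : SingularSimplex X p → R)
    (ψ : SingularSimplex X q → R) : cochainCupI n i φ ψ = 0 := by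
  refine funext fun σ ↦ ?_
  rw [cochainCupI_apply]
  refine sum_eq_zero fun U hU => ?_
  exfalso
  rw [mem_cupIDomain] at hU
  have := CupI.card_part0_add_card_part1 U
  omega


end Cochain

end Literature.AlgebraicTopology.SingularHomology
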